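import Mathlib
import Summits.SmoothPoincare4.SmoothPoincare4.Theorems.SoloBlindGenericState

/-!
# The cofactor of a child direction and its three cusp vectors (solo-blind s7)

Exact identities behind `paper/cs-gompf-classes.md` §4d R26 (solo seat `solo-SmoothPoincare4-blind`).
Setting (`SoloBlindGenericState`): `fPoly t x = x³ - t x² + (t-1) x - 1`, `θ` a root, `G = A x² + B x + C` a
direction with cusp values `P = G(0) = C`, `Q = G(1) = A + B + C`, norm `N(G) = normForm A B C t`.

1. COFACTOR.  `cofK A B C t x = K₂ x² + K₁ x + K₀` is the reduced polynomial with `K(θ) · G(θ) = N(G)`: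
   `cofK_mul` gives `K · G = normForm + fPoly · (explicit linear)` identically, hence `K(θ) G(θ) = N(G)` at a root
   (`cofK_mul_root`).  For a child `J' = J_G = G(θ) J / d` of a state `J` of norm `d` this `K(θ)/d` is the
   distinguished element of the colon lattice `Λ_{J'}` (since `(K/d) · J' = ± (N(G)/d²) J = ± d' J ⊆ d' O`).
2. THREE CUSP VECTORS.  Multiplying `K` by the units `x(x-1)`, `x²(x-1)`, `x(x-1)²` (units at a root:
   `root_unit`, `unit_xx1`) and reducing modulo `fPoly` gives three quadratic polynomials `M₁, M₂, M₃`
   (`cofM₁_eq`, `cofM₂_eq`, `cofM₃_eq`: `ε · K = M + fPoly · (explicit)`), whose cusp triples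
   (leading coefficient, value at 0, value at 1) are, with `E := A Q - A P - P Q`,
     `M₁ : (-E,  -(t A Q) + A² + 2 A Q + P Q - Q²,  -(t A P) + A² + A P + P² - P Q)`
     `M₂ : (t P Q - A Q + P² - 3 P Q + Q²,  -E,  -(t A P) + A² + 2 A P - A Q + P²)`
     `M₃ : (t P Q - A P + P² - 4 P Q + Q²,  t A Q - A² + A P - 3 A Q + Q²,  -E)`
   (`cofM₁_cusp`, `cofM₂_cusp`, `cofM₃_cusp`).  So each of the three unit multiples of the cofactor has ONE cusp
   value equal to `∓E` and the other two of size `≍ t·(pairwise cusp products of G)`: their cusp products are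
   `|E| · t² |A P Q| · {|A|, |P|, |Q|} · (1 + O(1/t))` against `N(G) = t² A P Q (1 + O(1/t))` — the exact form of the
   empirical margin-transfer law `μ(J_G) ≈ |E| · min(|A|,|P|,|Q|) / d` of R22 (as an upper bound unconditionally;
   as an equality under the conjecture COF of R26 that the systole of `Λ_{J_G}` is attained at one of these three
   vectors, verified in 395/395 cases).
Pure algebra (`ring` / `linear_combination`); the lattice statements and COF itself are in the paper, not here.
-/

namespace Summit.SmoothPoincare4.SmoothPoincare4.Theorems

section Cofactor
variable {R : Type*} [CommRing R]

/-- Leading coefficient of the cofactor polynomial. -/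
def cofK₂ (A B C t : R) : R := t * A ^ 2 + t * A * B - A ^ 2 - A * C + B ^ 2

/-- Linear coefficient of the cofactor polynomial. -/
def cofK₁ (A B C t : R) : R := -(t ^ 2 * A ^ 2) - t ^ 2 * A * B + t * A ^ 2 - t * B ^ 2 + A ^ 2 - B * C

/-- Constant coefficient of the cofactor polynomial. -/
def cofK₀ (A B C t : R) : R :=
  t ^ 2 * A ^ 2 + t ^ 2 * A * B + t ^ 2 * A * C - 3 * t * A ^ 2 - t * A * B - 2 * t * A * C + t * B ^ 2
    + t * B * C + A ^ 2 - A * B + 2 * A * C - B ^ 2 + C ^ 2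

/-- The cofactor polynomial `K(x)` of `G = A x² + B x + C` modulo `f_t`: `K(θ) G(θ) = N(G)`. -/
def cofK (A B C t x : R) : R := cofK₂ A B C t * x ^ 2 + cofK₁ A B C t * x + cofK₀ A B C t

/-- `K · G = N(G) + f_t · L` with an explicit linear `L`. -/
theorem cofK_mul (A B C t x : R) :
    cofK A B C t x * (A * x ^ 2 + B * x + C) =
      normForm A B C t + fPoly t x *
        ((t * A ^ 3 + t * A ^ 2 * B - A ^ 3 - A ^ 2 * C + A * B ^ 2) * x
          + (t * A ^ 2 * B - t * A ^ 2 * C + t * A * B ^ 2 + A ^ 3 - A ^ 2 * B - 2 * A * B * C + B ^ 3)) := by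
  unfold cofK cofK₂ cofK₁ cofK₀ normForm normE₁ normE₀ fPoly; ring

/-- At a root of `f_t`: `K(θ) · G(θ) = N(G)`. -/
theorem cofK_mul_root (A B C t x : R) (hf : fPoly t x = 0) :
    cofK A B C t x * (A * x ^ 2 + B * x + C) = normForm A B C t := by
  rw [cofK_mul, hf]; ring

/-- `x (x - 1)` is a unit at a root of `f_t` (inverse `x + 1 - t`). -/
theorem unit_xx1 (t x : R) (hf : fPoly t x = 0) : x * (x - 1) * (x + 1 - t) = 1 := by
  unfold fPoly at hf; linear_combination hf

/-- First unit multiple: `x(x-1) · K = M₁ + f_t · (K₂ x + M₁(0))`. -/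
theorem cofM₁_eq (A B C t x : R) :
    x * (x - 1) * cofK A B C t x =
      ((-(A ^ 2) - A * B + A * C + B * C + C ^ 2) * x ^ 2
        + (t * A ^ 2 + t * A * B + A * B - 2 * A * C + B ^ 2 - B * C - C ^ 2) * x
        + (-(t * A ^ 2) - t * A * B - t * A * C + 2 * A ^ 2 + A * C - B ^ 2 - B * C))
      + fPoly t x * (cofK₂ A B C t * x
        + (-(t * A ^ 2) - t * A * B - t * A * C + 2 * A ^ 2 + A * C - B ^ 2 - B * C)) := by
  unfold cofK cofK₂ cofK₁ cofK₀ fPoly; ring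

/-- Cusp triple of `M₁` in terms of `P = C`, `Q = A + B + C`, `E = A Q - A P - P Q`:
`(lead, M₁(0), M₁(1)) = (-E, -(t A Q) + A² + 2AQ + PQ - Q², -(t A P) + A² + AP + P² - PQ)`. -/
theorem cofM₁_cusp (A B C t : R) :
    (-(A ^ 2) - A * B + A * C + B * C + C ^ 2 = -(A * (A + B + C) - A * C - C * (A + B + C)))
    ∧ (-(t * A ^ 2) - t * A * B - t * A * C + 2 * A ^ 2 + A * C - B ^ 2 - B * C
        = -(t * A * (A + B + C)) + A ^ 2 + 2 * A * (A + B + C) + C * (A + B + C) - (A + B + C) ^ 2)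
    ∧ ((-(A ^ 2) - A * B + A * C + B * C + C ^ 2)
        + (t * A ^ 2 + t * A * B + A * B - 2 * A * C + B ^ 2 - B * C - C ^ 2)
        + (-(t * A ^ 2) - t * A * B - t * A * C + 2 * A ^ 2 + A * C - B ^ 2 - B * C)
        = -(t * A * C) + A ^ 2 + A * C + C ^ 2 - C * (A + B + C)) := by
  refine ⟨by ring, by ring, by ring⟩

/-- Second unit multiple: `x²(x-1) · K = M₂ + f_t · (K₂ x² + … )`. -/
theorem cofM₂_eq (A B C t x : R) :
    x ^ 2 * (x - 1) * cofK A B C t x =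
      ((t * A * C + t * B * C + t * C ^ 2 + A * B - 2 * A * C + B ^ 2 - B * C - C ^ 2) * x ^ 2
        + (-(2 * t * A * C) - t * B * C - t * C ^ 2 + A ^ 2 - A * B + 2 * A * C - B ^ 2 + C ^ 2) * x
        + (-(A ^ 2) - A * B + A * C + B * C + C ^ 2))
      + fPoly t x * (cofK₂ A B C t * x ^ 2
        + (-(t * A ^ 2) - t * A * B - t * A * C + 2 * A ^ 2 + A * C - B ^ 2 - B * C) * x
        + (-(A ^ 2) - A * B + A * C + B * C + C ^ 2)) := by
  unfold cofK cofK₂ cofK₁ cofK₀ fPoly; ring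

/-- Cusp triple of `M₂`: `(t P Q - A Q + P² - 3PQ + Q², -E, -(t A P) + A² + 2AP - AQ + P²)`. -/
theorem cofM₂_cusp (A B C t : R) :
    (t * A * C + t * B * C + t * C ^ 2 + A * B - 2 * A * C + B ^ 2 - B * C - C ^ 2
        = t * C * (A + B + C) - A * (A + B + C) + C ^ 2 - 3 * C * (A + B + C) + (A + B + C) ^ 2)
    ∧ (-(A ^ 2) - A * B + A * C + B * C + C ^ 2 = -(A * (A + B + C) - A * C - C * (A + B + C)))
    ∧ ((t * A * C + t * B * C + t * C ^ 2 + A * B - 2 * A * C + B ^ 2 - B * C - C ^ 2)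
        + (-(2 * t * A * C) - t * B * C - t * C ^ 2 + A ^ 2 - A * B + 2 * A * C - B ^ 2 + C ^ 2)
        + (-(A ^ 2) - A * B + A * C + B * C + C ^ 2)
        = -(t * A * C) + A ^ 2 + 2 * A * C - A * (A + B + C) + C ^ 2) := by
  refine ⟨by ring, by ring, by ring⟩

/-- Third unit multiple: `x(x-1)² · K = M₃ + f_t · ( … )`. -/
theorem cofM₃_eq (A B C t x : R) :
    x * (x - 1) ^ 2 * cofK A B C t x =
      ((t * A * C + t * B * C + t * C ^ 2 + A ^ 2 + 2 * A * B - 3 * A * C + B ^ 2 - 2 * B * C - 2 * C ^ 2) * x ^ 2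
        + (-(t * A ^ 2) - t * A * B - 2 * t * A * C - t * B * C - t * C ^ 2 + A ^ 2 - 2 * A * B + 4 * A * C
            - 2 * B ^ 2 + B * C + 2 * C ^ 2) * x
        + (t * A ^ 2 + t * A * B + t * A * C - 3 * A ^ 2 - A * B + B ^ 2 + 2 * B * C + C ^ 2))
      + fPoly t x * (cofK₂ A B C t * x ^ 2
        + (-(2 * t * A ^ 2) - 2 * t * A * B - t * A * C + 3 * A ^ 2 + 2 * A * C - 2 * B ^ 2 - B * C) * x
        + (t * A ^ 2 + t * A * B + t * A * C - 3 * A ^ 2 - A * B + B ^ 2 + 2 * B * C + C ^ 2)) := by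
  unfold cofK cofK₂ cofK₁ cofK₀ fPoly; ring

/-- Cusp triple of `M₃`: `(t P Q - A P + P² - 4PQ + Q², t A Q - A² + AP - 3AQ + Q², -E)`. -/
theorem cofM₃_cusp (A B C t : R) :
    (t * A * C + t * B * C + t * C ^ 2 + A ^ 2 + 2 * A * B - 3 * A * C + B ^ 2 - 2 * B * C - 2 * C ^ 2
        = t * C * (A + B + C) - A * C + C ^ 2 - 4 * C * (A + B + C) + (A + B + C) ^ 2)
    ∧ (t * A ^ 2 + t * A * B + t * A * C - 3 * A ^ 2 - A * B + B ^ 2 + 2 * B * C + C ^ 2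
        = t * A * (A + B + C) - A ^ 2 + A * C - 3 * A * (A + B + C) + (A + B + C) ^ 2)
    ∧ ((t * A * C + t * B * C + t * C ^ 2 + A ^ 2 + 2 * A * B - 3 * A * C + B ^ 2 - 2 * B * C - 2 * C ^ 2)
        + (-(t * A ^ 2) - t * A * B - 2 * t * A * C - t * B * C - t * C ^ 2 + A ^ 2 - 2 * A * B + 4 * A * C
            - 2 * B ^ 2 + B * C + 2 * C ^ 2) * 1
        + (t * A ^ 2 + t * A * B + t * A * C - 3 * A ^ 2 - A * B + B ^ 2 + 2 * B * C + C ^ 2)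
        = -(A * (A + B + C) - A * C - C * (A + B + C))) := by
  refine ⟨by ring, by ring, by ring⟩

/-- The margin numerator factorises three ways (used to count low-margin directions: each is a shifted
hyperbola in two of the cusp coordinates). -/
theorem cuspE_factor (A P Q : R) :
    A * Q - A * P - P * Q = -((P - A) * (Q + A)) - A ^ 2
    ∧ A * Q - A * P - P * Q = -((A + Q) * (P - Q)) - Q ^ 2
    ∧ A * Q - A * P - P * Q = (A - P) * (Q - P) - P ^ 2 := by
  refine ⟨by ring, by ring, by ring⟩

end Cofactor

end Summit.SmoothPoincare4.SmoothPoincare4.Theorems
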